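import Literature.Geometry.Kaehler.ComplexTorusHodgeGroupProductKernelsRational
import Literature.NumberTheory.Automorphic.TorusLieAlgebraIntegralSpan
import Literature.RepresentationTheory.FiniteGroups.PermutationModuleSignIsotypicStabilizer
import HarnessLib

/-!
# Joint-eigenvalue characters of an `Aut(ℂ)`-stable torus in `GL_N(ℂ)`: the Galois group permutes them, and a SIGN pair of
# joint eigenvectors in the span of the «`X`-type» characters is fixed by the stabiliser of one of them
# (the cocharacter form of Moonen–Zarhin 1999, §3, proof of Prop. (3.8): «it easily follows from Lemma (3.7)»)

Layer `Literature/Geometry/Kaehler`, namespace `Literature.Geometry.Kaehler.AutStableTorus`; lane `lit-hodgefound` (Track 2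
foundations library); prover seat `lit-hodgefound-p17` (generation 44, self-proposed row g44-#3).  THEOREMS ONLY (no definition, no
instance, no notation, no named fact; net debt 0).  It lives next to the lane's «algebraic `ℚ`-group» dictionary
(`ComplexTorusHodgeGroupProductKernelsRational`: an `Aut(ℂ)`-stable `M ≤ GL_ι(ℂ)` has `Lie M` `Aut(ℂ)`-stable and spanned over `ℂ`
by its RATIONAL POINTS, `map_mem_lieAlgebraGL_of_forall_map_mem` ∕ `coe_lieAlgebraGL_eq_span_ratCast_of_forall_map_mem`) and uses
the torus structure through `TorusLieAlgebraIntegralSpan` (g44-#2: `Lie(S)` is simultaneously diagonalisable and spanned by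
elements with INTEGER eigenvalues — Springer 4.4.13, `Lie S = X_*(S) ⊗ ℂ`) and the Galois-combinatorial lemma
`PermutationModuleSignIsotypicStabilizer` (g44-#1: Frobenius reciprocity for a sign character against a permutation module).

## The statement (`AutStableTorus.exists_jointEigenvector_forall_ringEquiv_apply_eq`)

Let `S ≤ GL_N(ℂ)` be a torus stable under every `σ ∈ Aut(ℂ)` (acting on entries) — the complex points of a `ℚ`-torus — and
`𝔰 = Lie(S)`.  A JOINT EIGENVECTOR of `𝔰` is `v ≠ 0` with `H v ∈ ℂ v` for all `H ∈ 𝔰`; its CHARACTER is the function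
`A ↦ (eigenvalue of A ⊗ 1 on v)` on the rational points `A ∈ M_N(ℚ)`, `A ⊗ 1 ∈ 𝔰` (and `0` elsewhere).  Since `𝔰` is the complex
span of its rational points, the character determines the eigenvalue of every `H ∈ 𝔰` on `v`; `Aut(ℂ)` acts on joint eigenvectors
coordinatewise and on characters by post-composition, `χ_{σ v} = σ ∘ χ_v`.  Suppose given

* a SIGN PAIR: joint eigenvectors `e₊, e₋` with opposite eigenvalues (`H e₊ = μ e₊ ⟹ H e₋ = -μ e₋`) such that every
  `σ ∈ Aut(ℂ)` either fixes both or swaps them (coordinatewise);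
* a rational matrix `P` (the «`X`-projection»), and the FINITE-KERNEL property: an `H ∈ 𝔰` killing every joint eigenvector `v`
  with `(P ⊗ 1) v ≠ 0` kills `e₊`;
* non-degeneracy: some `H ∈ 𝔰` does not kill `e₊`.

THEN there is a joint eigenvector `v` with `(P ⊗ 1) v ≠ 0` such that every `σ ∈ Aut(ℂ)` fixing the values of its character
(`σ μ = μ` whenever `A ⊗ 1 ∈ 𝔰`, `A` rational, `(A ⊗ 1) v = μ v`) FIXES `e₊`.

PROOF.  `W = {H ∈ 𝔰 | all joint eigenvalues of H are rational}` is an `Aut(ℂ)`-stable `ℚ`-form of `𝔰` (it contains the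
integer-eigenvalue spanning set of g44-#2); on `W` the joint-eigenvalue functionals `λ_χ` (indexed by the finitely many characters
`χ`) are `ℚ`-valued and permuted: `λ_χ(σH) = λ_{σ⁻¹∘χ}(H)`; the pair `χ_{e₊}, χ_{e₋}` is a sign pair with `λ_{χ_{e₋}} = -λ_{χ_{e₊}}`;
the finite-kernel property says `⋂_{χ X-type} ker λ_χ ≤ ker λ_{χ_{e₊}}` on `W`, and non-degeneracy says `λ_{χ_{e₊}} ≠ 0` on `W`
(because `W` spans `𝔰`).  g44-#1 then yields an `X`-type character `χ` whose stabiliser fixes `χ_{e₊}`, i.e. fixes `e₊`.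

## Why (consumer)

Moonen–Zarhin, *Hodge classes on abelian varieties of low dimension*, Math. Ann. 315 (1999), Prop. (3.8) (held
`paper:arxiv-math_9901113`, p0007 L55–L72): for `S = Z(Hg(X × E)(ℂ))° = R(Hg(X × E)(ℂ))`, `E` a CM elliptic curve with
`End⁰(E) = k = ℚ(τ)`, `e₊, e₋` the two `k ⊗ ℂ`-eigenlines of `H₁(E, ℂ)`, `P` the projection to `H₁(X, ℂ)`: the non-splitting
`Hg(X × E) ≠ Hg(X) × Hg(E)` is the non-degeneracy, the finiteness of the Goursat kernel `K₂` is the finite-kernel property, and the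
conclusion reads «`τ` lies in the number field generated by the eigenvalues of the centre of `End⁰(X)` on a common eigenvector»,
i.e. `k` embeds into the centre of `End⁰(X)` — the sequel `…HodgeGroupProductCMEllipticCurveCenterEmbedding` (g44-#4).

## References

* [MoonenZarhin1999LowDim] B. Moonen, Yu. G. Zarhin, Math. Ann. 315 (1999), §3 Lemma (3.6), Lemma (3.7), Prop. (3.8).
* [Springer1998] T. A. Springer, *Linear Algebraic Groups*, 2nd ed.: 3.2.3, 4.4.13, 11.1.4, 12.1.2, 13.1.1 (`F`-tori and the Galois
  action on `X*(T)`).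
* [Serre1977] J.-P. Serre, *Linear Representations of Finite Groups*, §7.2 (Frobenius reciprocity).
* [Borel1991] A. Borel, *Linear Algebraic Groups*, 2nd ed., §8.11 (`k`-tori: `Γ`-module `X*(T)`), AG §14.
-/

noncomputable section

open Matrix Module Function
open scoped MatrixGroups

namespace Literature.Geometry.Kaehler

namespace AutStableTorus

open Literature.NumberTheory.Automorphic (IsTorusSubgroup lieAlgebraGL)
open Literature.Geometry.Kaehler.ComplexTorus (map_mem_lieAlgebraGL_of_forall_map_mem
  coe_lieAlgebraGL_eq_span_ratCast_of_forall_map_mem)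
open Literature.RepresentationTheory.FiniteGroups (exists_mem_forall_apply_eq_of_forall_eq_zero)

variable {N : Type*} [Fintype N] [DecidableEq N]

/-! ### §0 Plumbing -/

omit [Fintype N] [DecidableEq N] in
/-- Eigenvalues on a non-zero vector are unique. [folklore] -/
private theorem eq_of_smul_eq_smul₄₄ {v : N → ℂ} (hv : v ≠ 0) {a b : ℂ} (h : a • v = b • v) : a = b := by
  have h' : (a - b) • v = 0 := by rw [sub_smul, h, sub_self]
  rcases smul_eq_zero.1 h' with h0 | h0
  · exact sub_eq_zero.1 h0
  · exact absurd h0 hv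

omit [DecidableEq N] in
/-- `σ(H v) = σ(H) σ(v)` (entrywise action of a ring automorphism). [folklore] -/
private theorem map_mulVec_comp₄₄ (σ : ℂ ≃+* ℂ) (H : Matrix N N ℂ) (v : N → ℂ) :
    (H.map σ) *ᵥ ((σ : ℂ → ℂ) ∘ v) = (σ : ℂ → ℂ) ∘ (H *ᵥ v) := by
  funext i
  have h := RingHom.map_mulVec (σ : ℂ →+* ℂ) H v i
  simp only [RingHom.coe_coe] at h
  rw [Function.comp_apply, h]

omit [Fintype N] [DecidableEq N] in
/-- `σ(μ v) = σ(μ) σ(v)`. [folklore] -/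
private theorem comp_smul₄₄ (σ : ℂ ≃+* ℂ) (μ : ℂ) (v : N → ℂ) :
    (σ : ℂ → ℂ) ∘ (μ • v) = σ μ • ((σ : ℂ → ℂ) ∘ v) := by
  funext i
  simp [map_mul]

omit [Fintype N] [DecidableEq N] in
/-- `σ⁻¹ (σ v) = v`. [folklore] -/
private theorem symm_comp_comp₄₄ (σ : ℂ ≃+* ℂ) (v : N → ℂ) :
    (σ.symm : ℂ → ℂ) ∘ ((σ : ℂ → ℂ) ∘ v) = v := by
  funext i; simp

omit [Fintype N] [DecidableEq N] in
/-- `σ (σ⁻¹ v) = v`. [folklore] -/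
private theorem comp_symm_comp₄₄ (σ : ℂ ≃+* ℂ) (v : N → ℂ) :
    (σ : ℂ → ℂ) ∘ ((σ.symm : ℂ → ℂ) ∘ v) = v := by
  funext i; simp

omit [Fintype N] [DecidableEq N] in
/-- `σ(v) ≠ 0` for `v ≠ 0`. [folklore] -/
private theorem comp_ne_zero₄₄ (σ : ℂ ≃+* ℂ) {v : N → ℂ} (hv : v ≠ 0) : (σ : ℂ → ℂ) ∘ v ≠ 0 := by
  intro h
  apply hv
  have h' := congrArg (fun w : N → ℂ ↦ (σ.symm : ℂ → ℂ) ∘ w) h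
  simp only [symm_comp_comp₄₄] at h'
  rw [h']
  funext i; simp

omit [Fintype N] [DecidableEq N] in
/-- Rational matrices are fixed entrywise by `Aut(ℂ)`. [folklore] -/
private theorem map_ratCast_map₄₄ (σ : ℂ ≃+* ℂ) (A : Matrix N N ℚ) :
    (A.map ((↑) : ℚ → ℂ)).map σ = A.map ((↑) : ℚ → ℂ) := by
  ext i j; simp

omit [Fintype N] [DecidableEq N] in
/-- `σ(σ⁻¹ H) = H` on matrices. [folklore] -/
private theorem map_symm_map₄₄ (σ : ℂ ≃+* ℂ) (H : Matrix N N ℂ) : (H.map σ.symm).map σ = H := by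
  ext i j; simp

/-- **Eigenvalues are read in a diagonalising basis**: if `g H g⁻¹ = diag(d)` and `H v = μ v` with `(g v)_a ≠ 0`, then `μ = d_a`.
[folklore] -/
private theorem eq_diag_of_mulVec_eq_smul₄₄ {g : GL N ℂ} {H : Matrix N N ℂ} {d : N → ℂ}
    (hd : (g : Matrix N N ℂ) * H * ((g⁻¹ : GL N ℂ) : Matrix N N ℂ) = diagonal d) {v : N → ℂ} {μ : ℂ}
    (hv : H *ᵥ v = μ • v) {a : N} (ha : ((g : Matrix N N ℂ) *ᵥ v) a ≠ 0) : μ = d a := by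
  have hginv : ((g⁻¹ : GL N ℂ) : Matrix N N ℂ) *ᵥ ((g : Matrix N N ℂ) *ᵥ v) = v := by
    rw [mulVec_mulVec, ← Units.val_mul, inv_mul_cancel, Units.val_one, one_mulVec]
  have h1 : (g : Matrix N N ℂ) *ᵥ (H *ᵥ v) = diagonal d *ᵥ ((g : Matrix N N ℂ) *ᵥ v) := by
    rw [← hd, ← mulVec_mulVec, ← mulVec_mulVec, hginv]
  rw [hv, mulVec_smul] at h1
  have h2 := congrFun h1 a
  rw [Pi.smul_apply, smul_eq_mul, mulVec_diagonal] at h2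
  exact mul_right_cancel₀ ha h2

/-- `g v ≠ 0` for invertible `g` and `v ≠ 0`. [folklore] -/
private theorem mulVec_ne_zero₄₄ (g : GL N ℂ) {v : N → ℂ} (hv : v ≠ 0) : (g : Matrix N N ℂ) *ᵥ v ≠ 0 := by
  intro h
  apply hv
  have h' : ((g⁻¹ : GL N ℂ) : Matrix N N ℂ) *ᵥ ((g : Matrix N N ℂ) *ᵥ v) = v := by
    rw [mulVec_mulVec, ← Units.val_mul, inv_mul_cancel, Units.val_one, one_mulVec]
  rw [← h', h, mulVec_zero]

/-- The columns of `g⁻¹` are joint eigenvectors when `g` diagonalises: `g H g⁻¹ = diag(d) ⟹ H (g⁻¹ e_a) = d_a · g⁻¹ e_a`.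
[folklore] -/
private theorem mulVec_inv_single_eq_smul₄₄ {g : GL N ℂ} {H : Matrix N N ℂ} {d : N → ℂ}
    (hd : (g : Matrix N N ℂ) * H * ((g⁻¹ : GL N ℂ) : Matrix N N ℂ) = diagonal d) (a : N) :
    H *ᵥ (((g⁻¹ : GL N ℂ) : Matrix N N ℂ) *ᵥ Pi.single a 1) =
      d a • (((g⁻¹ : GL N ℂ) : Matrix N N ℂ) *ᵥ Pi.single a 1) := by
  have hH : H = ((g⁻¹ : GL N ℂ) : Matrix N N ℂ) * diagonal d * (g : Matrix N N ℂ) := by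
    rw [← hd, Literature.NumberTheory.Automorphic.units_inv_conj_conj]
  have hgg : (g : Matrix N N ℂ) * ((g⁻¹ : GL N ℂ) : Matrix N N ℂ) = 1 := by
    rw [← Units.val_mul, mul_inv_cancel, Units.val_one]
  conv_lhs => rw [hH]
  rw [mulVec_mulVec, Matrix.mul_assoc, hgg, Matrix.mul_one, ← mulVec_mulVec, diagonal_mulVec_single, mul_one,
    ← mulVec_smul]
  congr 1
  ext b
  simp [Pi.single_apply]

/-- `g⁻¹ e_a ≠ 0`. [folklore] -/
private theorem inv_mulVec_single_ne_zero₄₄ (g : GL N ℂ) (a : N) :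
    ((g⁻¹ : GL N ℂ) : Matrix N N ℂ) *ᵥ Pi.single a 1 ≠ 0 :=
  mulVec_ne_zero₄₄ g⁻¹ (by
    intro h
    have h' := congrFun h a
    simp at h')

/-! ### §1 The theorem -/

/-- **MOONEN–ZARHIN'S «IT EASILY FOLLOWS FROM LEMMA (3.7)», COCHARACTER FORM.**  Let `S ≤ GL_N(ℂ)` be an `Aut(ℂ)`-stable torus,
`𝔰 = Lie(S)`.  Let `e₊, e₋` be joint eigenvectors of `𝔰` with opposite eigenvalues, swapped-or-fixed by every `σ ∈ Aut(ℂ)`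
(coordinatewise); let `P` be a rational matrix such that every `H ∈ 𝔰` killing all joint eigenvectors `v` with `(P ⊗ 1) v ≠ 0`
kills `e₊` (finite kernel), and assume some `H ∈ 𝔰` does not kill `e₊`.  Then some joint eigenvector `v` of `𝔰` with
`(P ⊗ 1) v ≠ 0` has the property: every `σ ∈ Aut(ℂ)` fixing the eigenvalues on `v` of the rational points `A ⊗ 1 ∈ 𝔰` fixes
`e₊`.  (With `S = Z(Hg(X × E)(ℂ))°`, `E` a CM elliptic curve, this is «there is a homomorphism `U_k → U_{F_1} × ⋯ × U_{F_n}` with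
finite kernel […] it easily follows from Lemma (3.7) that there exists an embedding `k → F_i`».)
[cite: MoonenZarhin1999LowDim, §3 Prop. (3.8), proof (p0007 L59–L63)] [cite: Springer1998, 13.1.1 and 12.1.2]
[cite: Serre1977, §7.2 Prop. 21] -/
theorem exists_jointEigenvector_forall_ringEquiv_apply_eq
    {S : Subgroup (GL N ℂ)} (hS : IsTorusSubgroup S)
    (hstab : ∀ (σ : ℂ ≃+* ℂ) (g : GL N ℂ), g ∈ S → Matrix.GeneralLinearGroup.map (σ : ℂ →+* ℂ) g ∈ S)
    {eP eM : N → ℂ} (heP : eP ≠ 0) (heM : eM ≠ 0)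
    (hopp : ∀ H ∈ lieAlgebraGL S, ∃ μ : ℂ, H *ᵥ eP = μ • eP ∧ H *ᵥ eM = -(μ • eM))
    (hswap : ∀ σ : ℂ ≃+* ℂ,
      ((σ : ℂ → ℂ) ∘ eP = eP ∧ (σ : ℂ → ℂ) ∘ eM = eM) ∨ ((σ : ℂ → ℂ) ∘ eP = eM ∧ (σ : ℂ → ℂ) ∘ eM = eP))
    (P : Matrix N N ℚ)
    (hker : ∀ H ∈ lieAlgebraGL S,
      (∀ v : N → ℂ, v ≠ 0 → P.map ((↑) : ℚ → ℂ) *ᵥ v ≠ 0 →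
        (∀ H' ∈ lieAlgebraGL S, ∃ μ : ℂ, H' *ᵥ v = μ • v) → H *ᵥ v = 0) → H *ᵥ eP = 0)
    (hnz : ∃ H ∈ lieAlgebraGL S, H *ᵥ eP ≠ 0) :
    ∃ v : N → ℂ, v ≠ 0 ∧ P.map ((↑) : ℚ → ℂ) *ᵥ v ≠ 0 ∧ (∀ H ∈ lieAlgebraGL S, ∃ μ : ℂ, H *ᵥ v = μ • v) ∧
      ∀ σ : ℂ ≃+* ℂ, (∀ A : Matrix N N ℚ, A.map ((↑) : ℚ → ℂ) ∈ lieAlgebraGL S →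
        ∀ μ : ℂ, A.map ((↑) : ℚ → ℂ) *ᵥ v = μ • v → σ μ = μ) → (σ : ℂ → ℂ) ∘ eP = eP := by
  classical
  set L := lieAlgebraGL S with hL
  -- `Lie S` is `Aut(ℂ)`-stable and spanned by its rational points
  have hLstab : ∀ (σ : ℂ ≃+* ℂ) {H : Matrix N N ℂ}, H ∈ L → H.map σ ∈ L :=
    fun σ _ hH ↦ map_mem_lieAlgebraGL_of_forall_map_mem hstab σ hH
  have hLspan := coe_lieAlgebraGL_eq_span_ratCast_of_forall_map_mem hstab
  -- simultaneous diagonalisation and the integer span (g44-#2)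
  obtain ⟨g, hdiag, hZspan⟩ := hS.exists_conj_span_integral_eigenvalues
  -- joint eigenvectors and their eigenvalues
  set JE : (N → ℂ) → Prop := fun v ↦ v ≠ 0 ∧ ∀ H ∈ L, ∃ μ : ℂ, H *ᵥ v = μ • v with hJE
  set ev : (N → ℂ) → Matrix N N ℂ → ℂ := fun v H ↦ if h : ∃ μ : ℂ, H *ᵥ v = μ • v then h.choose else 0 with hev
  have hev_eq : ∀ {v : N → ℂ} {H : Matrix N N ℂ} {μ : ℂ}, v ≠ 0 → H *ᵥ v = μ • v → ev v H = μ := by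
    intro v H μ hv hH
    have h : ∃ μ : ℂ, H *ᵥ v = μ • v := ⟨μ, hH⟩
    have h1 : ev v H = h.choose := by simp only [hev, dif_pos h]
    rw [h1]
    exact eq_of_smul_eq_smul₄₄ hv (h.choose_spec.symm.trans hH)
  have hev_spec : ∀ {v : N → ℂ}, JE v → ∀ H ∈ L, H *ᵥ v = ev v H • v := by
    intro v hv H hH
    obtain ⟨μ, hμ⟩ := hv.2 H hH
    rw [hev_eq hv.1 hμ]
    exact hμ
  -- the character of a joint eigenvector on rational points
  set ch : (N → ℂ) → (Matrix N N ℚ → ℂ) := fun v A ↦ if A.map ((↑) : ℚ → ℂ) ∈ L then ev v (A.map ((↑) : ℚ → ℂ)) else 0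
    with hch
  have hch_of_mem : ∀ (v : N → ℂ) {A : Matrix N N ℚ}, A.map ((↑) : ℚ → ℂ) ∈ L →
      ch v A = ev v (A.map ((↑) : ℚ → ℂ)) := fun v A hA ↦ by simp only [hch, if_pos hA]
  have hch_of_not_mem : ∀ (v : N → ℂ) {A : Matrix N N ℚ}, A.map ((↑) : ℚ → ℂ) ∉ L → ch v A = 0 :=
    fun v A hA ↦ by simp only [hch, if_neg hA]
  -- (a) `σ` acts on joint eigenvectors and characters
  have hJEσ : ∀ (σ : ℂ ≃+* ℂ) {v : N → ℂ}, JE v → JE ((σ : ℂ → ℂ) ∘ v) := by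
    intro σ v hv
    refine ⟨comp_ne_zero₄₄ σ hv.1, fun H hH ↦ ?_⟩
    obtain ⟨μ, hμ⟩ := hv.2 _ (hLstab σ.symm hH)
    refine ⟨σ μ, ?_⟩
    rw [← map_symm_map₄₄ σ H, map_mulVec_comp₄₄, hμ, comp_smul₄₄]
  have hchσ : ∀ (σ : ℂ ≃+* ℂ) {v : N → ℂ}, JE v → ch ((σ : ℂ → ℂ) ∘ v) = (σ : ℂ → ℂ) ∘ ch v := by
    intro σ v hv
    funext A
    by_cases hA : A.map ((↑) : ℚ → ℂ) ∈ L
    · rw [Function.comp_apply, hch_of_mem _ hA, hch_of_mem _ hA]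
      apply hev_eq (comp_ne_zero₄₄ σ hv.1)
      have h := hev_spec hv _ hA
      have h2 : A.map ((↑) : ℚ → ℂ) *ᵥ ((σ : ℂ → ℂ) ∘ v) = (A.map ((↑) : ℚ → ℂ)).map σ *ᵥ ((σ : ℂ → ℂ) ∘ v) := by
        rw [map_ratCast_map₄₄]
      rw [h2, map_mulVec_comp₄₄, h, comp_smul₄₄]
    · rw [Function.comp_apply, hch_of_not_mem _ hA, hch_of_not_mem _ hA, map_zero]
  -- (b) the character determines the eigenvalues on all of `L`
  have hchar : ∀ {v w : N → ℂ}, JE v → JE w → ch v = ch w → ∀ H ∈ L, ev v H = ev w H := by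
    intro v w hv hw hvw H hH
    suffices key : ∀ H' ∈ Submodule.span ℂ ((fun A : Matrix N N ℚ ↦ A.map ((↑) : ℚ → ℂ)) ''
        {A : Matrix N N ℚ | A.map ((↑) : ℚ → ℂ) ∈ lieAlgebraGL S}), ∃ μ : ℂ, H' *ᵥ v = μ • v ∧ H' *ᵥ w = μ • w by
      have hH' : H ∈ (L : Set (Matrix N N ℂ)) := hH
      rw [hLspan] at hH'
      obtain ⟨μ, hμv, hμw⟩ := key H hH'
      rw [hev_eq hv.1 hμv, hev_eq hw.1 hμw]
    intro H' hH'
    induction hH' using Submodule.span_induction with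
    | mem Y hY =>
      obtain ⟨A, hA, rfl⟩ := hY
      refine ⟨ch v A, ?_, ?_⟩
      · rw [hch_of_mem _ hA]; exact hev_spec hv _ hA
      · rw [hvw, hch_of_mem _ hA]; exact hev_spec hw _ hA
    | zero => exact ⟨0, by rw [zero_mulVec, zero_smul], by rw [zero_mulVec, zero_smul]⟩
    | add Y Y' _ _ hY hY' =>
      obtain ⟨μ, h1, h2⟩ := hY
      obtain ⟨μ', h1', h2'⟩ := hY'
      exact ⟨μ + μ', by rw [add_mulVec, h1, h1', add_smul], by rw [add_mulVec, h2, h2', add_smul]⟩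
    | smul c Y _ hY =>
      obtain ⟨μ, h1, h2⟩ := hY
      exact ⟨c * μ, by rw [smul_mulVec, h1, smul_smul], by rw [smul_mulVec, h2, smul_smul]⟩
  -- (c) the eigenbasis `g⁻¹ e_a`; every character is one of finitely many
  have hva : ∀ a : N, JE (((g⁻¹ : GL N ℂ) : Matrix N N ℂ) *ᵥ Pi.single a 1) := by
    intro a
    refine ⟨inv_mulVec_single_ne_zero₄₄ g a, fun H hH ↦ ?_⟩
    obtain ⟨d, hd⟩ := hdiag H hH
    exact ⟨d a, mulVec_inv_single_eq_smul₄₄ hd a⟩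
  have hch_eq_basis : ∀ {v : N → ℂ}, JE v →
      ∃ a : N, ch v = ch (((g⁻¹ : GL N ℂ) : Matrix N N ℂ) *ᵥ Pi.single a 1) := by
    intro v hv
    have hgv : (g : Matrix N N ℂ) *ᵥ v ≠ 0 := mulVec_ne_zero₄₄ g hv.1
    obtain ⟨a, ha⟩ : ∃ a : N, ((g : Matrix N N ℂ) *ᵥ v) a ≠ 0 := by
      by_contra hcon
      exact hgv (funext fun a ↦ not_not.1 fun h ↦ hcon ⟨a, h⟩)
    refine ⟨a, funext fun A ↦ ?_⟩
    by_cases hA : A.map ((↑) : ℚ → ℂ) ∈ L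
    · rw [hch_of_mem _ hA, hch_of_mem _ hA]
      obtain ⟨d, hd⟩ := hdiag _ hA
      have h1 : ev v (A.map ((↑) : ℚ → ℂ)) = d a := eq_diag_of_mulVec_eq_smul₄₄ hd (hev_spec hv _ hA) ha
      have h2 : ev (((g⁻¹ : GL N ℂ) : Matrix N N ℂ) *ᵥ Pi.single a 1) (A.map ((↑) : ℚ → ℂ)) = d a :=
        hev_eq (hva a).1 (mulVec_inv_single_eq_smul₄₄ hd a)
      rw [h1, h2]
    · rw [hch_of_not_mem _ hA, hch_of_not_mem _ hA]
  -- the index set of characters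
  set I₀ : Set (Matrix N N ℚ → ℂ) := {χ | ∃ v, JE v ∧ χ = ch v} with hI₀
  have hI₀fin : I₀.Finite := by
    refine (Set.finite_range fun a : N ↦ ch (((g⁻¹ : GL N ℂ) : Matrix N N ℂ) *ᵥ Pi.single a 1)).subset ?_
    rintro χ ⟨v, hv, rfl⟩
    obtain ⟨a, ha⟩ := hch_eq_basis hv
    exact ⟨a, ha.symm⟩
  haveI : Finite I₀ := hI₀fin.to_subtype
  letI : Fintype I₀ := Fintype.ofFinite I₀
  -- (d) the permutation action of `Aut(ℂ)` on characters
  have hπmem : ∀ (σ : ℂ ≃+* ℂ) {χ : Matrix N N ℚ → ℂ}, χ ∈ I₀ → (σ : ℂ → ℂ) ∘ χ ∈ I₀ := by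
    rintro σ χ ⟨v, hv, rfl⟩
    exact ⟨(σ : ℂ → ℂ) ∘ v, hJEσ σ hv, (hchσ σ hv).symm⟩
  let πfun : (ℂ ≃+* ℂ) → I₀ → I₀ := fun σ χ ↦ ⟨(σ : ℂ → ℂ) ∘ (χ : Matrix N N ℚ → ℂ), hπmem σ χ.2⟩
  have hπfun : ∀ (σ : ℂ ≃+* ℂ) (χ : I₀), ((πfun σ χ : I₀) : Matrix N N ℚ → ℂ) = (σ : ℂ → ℂ) ∘ (χ : Matrix N N ℚ → ℂ) :=
    fun _ _ ↦ rfl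
  let πeq : (ℂ ≃+* ℂ) → Equiv.Perm I₀ := fun σ ↦
    { toFun := πfun σ
      invFun := πfun σ⁻¹
      left_inv := fun χ ↦ Subtype.ext (funext fun A ↦ by
        change σ.symm (σ ((χ : Matrix N N ℚ → ℂ) A)) = _
        exact σ.symm_apply_apply _)
      right_inv := fun χ ↦ Subtype.ext (funext fun A ↦ by
        change σ (σ.symm ((χ : Matrix N N ℚ → ℂ) A)) = _
        exact σ.apply_symm_apply _) }
  let π : (ℂ ≃+* ℂ) →* Equiv.Perm I₀ :=
    { toFun := πeq
      map_one' := Equiv.ext fun χ ↦ Subtype.ext (funext fun A ↦ rfl)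
      map_mul' := fun σ τ ↦ Equiv.ext fun χ ↦ Subtype.ext (funext fun A ↦ rfl) }
  have hπ : ∀ (σ : ℂ ≃+* ℂ) (χ : I₀), ((π σ χ : I₀) : Matrix N N ℚ → ℂ) = (σ : ℂ → ℂ) ∘ (χ : Matrix N N ℚ → ℂ) :=
    fun _ _ ↦ rfl
  have hπinv : ∀ (σ : ℂ ≃+* ℂ) (χ : I₀),
      (((π σ)⁻¹ χ : I₀) : Matrix N N ℚ → ℂ) = (σ.symm : ℂ → ℂ) ∘ (χ : Matrix N N ℚ → ℂ) :=
    fun _ _ ↦ rfl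
  -- (e) the rational form `W`
  let W : Submodule ℚ (Matrix N N ℂ) :=
    { carrier := {H | H ∈ L ∧ ∀ v, JE v → ∃ q : ℚ, H *ᵥ v = ((q : ℂ)) • v}
      zero_mem' := ⟨L.zero_mem, fun v _ ↦ ⟨0, by rw [zero_mulVec, Rat.cast_zero, zero_smul]⟩⟩
      add_mem' := fun {H H'} hH hH' ↦ ⟨L.add_mem hH.1 hH'.1, fun v hv ↦ by
        obtain ⟨q, hq⟩ := hH.2 v hv
        obtain ⟨q', hq'⟩ := hH'.2 v hv
        exact ⟨q + q', by rw [add_mulVec, hq, hq', Rat.cast_add, add_smul]⟩⟩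
      smul_mem' := fun c H hH ↦ by
        have h : c • H = ((c : ℂ)) • H := by
          ext i j; simp [Matrix.smul_apply, Algebra.smul_def]
        refine ⟨?_, fun v hv ↦ ?_⟩
        · rw [h]; exact L.smul_mem _ hH.1
        · obtain ⟨q, hq⟩ := hH.2 v hv
          exact ⟨c * q, by rw [h, smul_mulVec, hq, smul_smul, Rat.cast_mul]⟩ }
  have hmemW : ∀ {H : Matrix N N ℂ}, H ∈ W ↔ H ∈ L ∧ ∀ v, JE v → ∃ q : ℚ, H *ᵥ v = ((q : ℂ)) • v :=
    fun {_} ↦ Iff.rfl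
  -- `W` is `Aut(ℂ)`-stable
  have hWσ : ∀ (σ : ℂ ≃+* ℂ) {H : Matrix N N ℂ}, H ∈ W → H.map σ ∈ W := by
    intro σ H hH
    refine hmemW.2 ⟨hLstab σ hH.1, fun v hv ↦ ?_⟩
    obtain ⟨q, hq⟩ := hH.2 _ (hJEσ σ.symm hv)
    refine ⟨q, ?_⟩
    rw [← comp_symm_comp₄₄ σ v, map_mulVec_comp₄₄, hq, comp_smul₄₄, map_ratCast]
  let ρ : (ℂ ≃+* ℂ) → W →ₗ[ℚ] W := fun σ ↦
    { toFun := fun H ↦ ⟨(H : Matrix N N ℂ).map σ, hWσ σ H.2⟩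
      map_add' := fun H H' ↦ Subtype.ext (by
        change ((H : Matrix N N ℂ) + (H' : Matrix N N ℂ)).map σ = (H : Matrix N N ℂ).map σ + (H' : Matrix N N ℂ).map σ
        exact Matrix.map_add _ (map_add σ) _ _)
      map_smul' := fun c H ↦ Subtype.ext (by
        ext i j
        change σ ((c • (H : Matrix N N ℂ)) i j) = (c • ((H : Matrix N N ℂ).map σ)) i j
        simp [Matrix.smul_apply, Algebra.smul_def, map_mul]) }
  have hρ : ∀ (σ : ℂ ≃+* ℂ) (H : W), ((ρ σ H : W) : Matrix N N ℂ) = (H : Matrix N N ℂ).map σ := fun _ _ ↦ rfl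
  -- (f) the functionals: a chosen eigenvector for each character
  have hIv : ∀ χ : I₀, ∃ v, JE v ∧ (χ : Matrix N N ℚ → ℂ) = ch v := fun χ ↦ χ.2
  choose vχ hvχ hchχ using hIv
  have hlamex : ∀ (χ : I₀) (H : W), ∃ q : ℚ, (H : Matrix N N ℂ) *ᵥ vχ χ = ((q : ℂ)) • vχ χ :=
    fun χ H ↦ H.2.2 _ (hvχ χ)
  choose lamFun hlamFun using hlamex
  have hlam_unique : ∀ (χ : I₀) (H : W) (q : ℚ), (H : Matrix N N ℂ) *ᵥ vχ χ = ((q : ℂ)) • vχ χ → lamFun χ H = q := by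
    intro χ H q hq
    exact_mod_cast eq_of_smul_eq_smul₄₄ (hvχ χ).1 ((hlamFun χ H).symm.trans hq)
  let lam : I₀ → W →ₗ[ℚ] ℚ := fun χ ↦
    { toFun := lamFun χ
      map_add' := fun H H' ↦ hlam_unique χ (H + H') _ (by
        rw [Submodule.coe_add, add_mulVec, hlamFun, hlamFun, Rat.cast_add, add_smul])
      map_smul' := fun c H ↦ hlam_unique χ (c • H) _ (by
        have h : ((c • H : W) : Matrix N N ℂ) = ((c : ℂ)) • (H : Matrix N N ℂ) := by
          rw [Submodule.coe_smul]; ext i j; simp [Matrix.smul_apply, Algebra.smul_def]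
        rw [h, smul_mulVec, hlamFun, smul_smul, smul_eq_mul, Rat.cast_mul]
        rfl) }
  have hlam : ∀ (χ : I₀) (H : W), (H : Matrix N N ℂ) *ᵥ vχ χ = (((lam χ H : ℚ) : ℂ)) • vχ χ := hlamFun
  -- eigenvalue of `H ∈ W` on ANY eigenvector with character `χ`
  have hlam_any : ∀ (χ : I₀) (H : W) {v : N → ℂ}, JE v → ch v = (χ : Matrix N N ℚ → ℂ) →
      (H : Matrix N N ℂ) *ᵥ v = (((lam χ H : ℚ) : ℂ)) • v := by
    intro χ H v hv hcv
    have h1 := hev_spec hv _ H.2.1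
    have h2 : ev v H = ev (vχ χ) H := hchar hv (hvχ χ) (hcv.trans (hchχ χ)) _ H.2.1
    rw [h1, h2, hev_eq (hvχ χ).1 (hlam χ H)]
  -- (g) the marked characters of `e₊`, `e₋`
  have hJEP : JE eP := ⟨heP, fun H hH ↦ by obtain ⟨μ, h, -⟩ := hopp H hH; exact ⟨μ, h⟩⟩
  have hJEM : JE eM := ⟨heM, fun H hH ↦ by
    obtain ⟨μ, -, h⟩ := hopp H hH; exact ⟨-μ, by rw [h, neg_smul]⟩⟩
  let iP : I₀ := ⟨ch eP, eP, hJEP, rfl⟩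
  let iM : I₀ := ⟨ch eM, eM, hJEM, rfl⟩
  have hne : iP ≠ iM := by
    intro h
    have hch' : ch eP = ch eM := congrArg Subtype.val h
    obtain ⟨H₀, hH₀, hH₀P⟩ := hnz
    obtain ⟨μ, hμP, hμM⟩ := hopp H₀ hH₀
    have h1 : ev eP H₀ = μ := hev_eq heP hμP
    have h2 : ev eM H₀ = -μ := hev_eq heM (by rw [hμM, neg_smul])
    have h3 := hchar hJEP hJEM hch' H₀ hH₀
    rw [h1, h2] at h3
    have hμ0 : μ = 0 := by
      have : (2 : ℂ) * μ = 0 := by rw [two_mul]; nth_rewrite 1 [h3]; exact neg_add_cancel μ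
      exact (mul_eq_zero.1 this).resolve_left two_ne_zero
    exact hH₀P (by rw [hμP, hμ0, zero_smul])
  -- hypotheses of the Frobenius-reciprocity lemma
  have hperm : ∀ (σ : ℂ ≃+* ℂ) (χ : I₀) (H : W), lam χ (ρ σ H) = lam ((π σ)⁻¹ χ) H := by
    intro σ χ H
    apply hlam_unique
    -- `H (σ⁻¹ v_χ) = q • σ⁻¹ v_χ` with `q = lam (σ⁻¹ χ) H`, then apply `σ`
    have hv' : JE ((σ.symm : ℂ → ℂ) ∘ vχ χ) := hJEσ σ.symm (hvχ χ)
    have hcv' : ch ((σ.symm : ℂ → ℂ) ∘ vχ χ) = (((π σ)⁻¹ χ : I₀) : Matrix N N ℚ → ℂ) := by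
      rw [hπinv, hchσ σ.symm (hvχ χ), hchχ]
    have h := hlam_any ((π σ)⁻¹ χ) H hv' hcv'
    rw [hρ, ← comp_symm_comp₄₄ σ (vχ χ), map_mulVec_comp₄₄, h, comp_smul₄₄, map_ratCast]
  have hneg : ∀ H : W, lam iM H = -lam iP H := by
    intro H
    obtain ⟨μ, hμP, hμM⟩ := hopp _ H.2.1
    have hP' := hlam_any iP H hJEP rfl
    have hM' := hlam_any iM H hJEM rfl
    have h1 : (((lam iP H : ℚ) : ℂ)) = μ := eq_of_smul_eq_smul₄₄ heP (hP'.symm.trans hμP)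
    have h2 : (((lam iM H : ℚ) : ℂ)) = -μ := eq_of_smul_eq_smul₄₄ heM (hM'.symm.trans (by rw [hμM, neg_smul]))
    exact_mod_cast (show (((lam iM H : ℚ) : ℂ)) = -(((lam iP H : ℚ) : ℂ)) by rw [h2, h1])
  have hpair : ∀ σ : ℂ ≃+* ℂ, (π σ iP = iP ∧ π σ iM = iM) ∨ (π σ iP = iM ∧ π σ iM = iP) := by
    intro σ
    rcases hswap σ with ⟨h1, h2⟩ | ⟨h1, h2⟩
    · refine Or.inl ⟨Subtype.ext ?_, Subtype.ext ?_⟩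
      · rw [hπ]; change (σ : ℂ → ℂ) ∘ ch eP = ch eP; rw [← hchσ σ hJEP, h1]
      · rw [hπ]; change (σ : ℂ → ℂ) ∘ ch eM = ch eM; rw [← hchσ σ hJEM, h2]
    · refine Or.inr ⟨Subtype.ext ?_, Subtype.ext ?_⟩
      · rw [hπ]; change (σ : ℂ → ℂ) ∘ ch eP = ch eM; rw [← hchσ σ hJEP, h1]
      · rw [hπ]; change (σ : ℂ → ℂ) ∘ ch eM = ch eP; rw [← hchσ σ hJEM, h2]
  set J : Set I₀ := {χ | ∃ v, JE v ∧ (χ : Matrix N N ℚ → ℂ) = ch v ∧ P.map ((↑) : ℚ → ℂ) *ᵥ v ≠ 0} with hJ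
  have hJstab : ∀ (σ : ℂ ≃+* ℂ), ∀ χ ∈ J, π σ χ ∈ J := by
    rintro σ χ ⟨v, hv, hcv, hPv⟩
    refine ⟨(σ : ℂ → ℂ) ∘ v, hJEσ σ hv, ?_, ?_⟩
    · rw [hπ, hcv, hchσ σ hv]
    · rw [← map_ratCast_map₄₄ σ P, map_mulVec_comp₄₄]
      exact comp_ne_zero₄₄ σ hPv
  have hker' : ∀ H : W, (∀ χ ∈ J, lam χ H = 0) → lam iP H = 0 := by
    intro H hH
    have hHP : (H : Matrix N N ℂ) *ᵥ eP = 0 := by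
      refine hker _ H.2.1 fun v hv hPv hv' ↦ ?_
      have hvJE : JE v := ⟨hv, hv'⟩
      let χ : I₀ := ⟨ch v, v, hvJE, rfl⟩
      have hχ : χ ∈ J := ⟨v, hvJE, rfl, hPv⟩
      have h := hlam_any χ H hvJE rfl
      rw [hH χ hχ, Rat.cast_zero, zero_smul] at h
      exact h
    apply hlam_unique
    rw [Rat.cast_zero, zero_smul]
    have h := hlam_any iP H hJEP rfl
    have h0 : (((lam iP H : ℚ) : ℂ)) = 0 := eq_of_smul_eq_smul₄₄ heP (h.symm.trans (by rw [hHP, zero_smul]))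
    rw [hlam, h0, zero_smul]
  have hnz' : lam iP ≠ 0 := by
    intro h0
    -- every integer-eigenvalue element of `L` lies in `W`, hence kills `e₊`; they span `L`
    have hkill : ∀ H ∈ L, H *ᵥ eP = 0 := by
      intro H hH
      have hsub : L ≤ Submodule.span ℂ {H : Matrix N N ℂ | H *ᵥ eP = 0 ∧ H ∈ L} := by
        refine hZspan.trans (Submodule.span_mono ?_)
        rintro H ⟨hHL, hint⟩
        refine ⟨?_, hHL⟩
        -- `H ∈ W`
        have hHW : H ∈ W := by
          refine hmemW.2 ⟨hHL, fun v hv ↦ ?_⟩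
          have hgv : (g : Matrix N N ℂ) *ᵥ v ≠ 0 := mulVec_ne_zero₄₄ g hv.1
          obtain ⟨a, ha⟩ : ∃ a : N, ((g : Matrix N N ℂ) *ᵥ v) a ≠ 0 := by
            by_contra hcon
            exact hgv (funext fun a ↦ not_not.1 fun h ↦ hcon ⟨a, h⟩)
          obtain ⟨z, hz⟩ := hint a
          obtain ⟨d, hd⟩ := hdiag H hHL
          have hda : d a = (z : ℂ) := by rw [← hz, hd, diagonal_apply_eq]
          refine ⟨(z : ℚ), ?_⟩
          rw [hev_spec hv H hHL, eq_diag_of_mulVec_eq_smul₄₄ hd (hev_spec hv H hHL) ha, hda, Rat.cast_intCast]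
        have h := hlam_any iP ⟨H, hHW⟩ hJEP rfl
        rw [h0, LinearMap.zero_apply, Rat.cast_zero, zero_smul] at h
        exact h
      have hmem := hsub hH
      -- the set `{H | H e₊ = 0 ∧ H ∈ L}` spans a submodule all of whose elements kill `e₊`
      suffices hspan : ∀ H' ∈ Submodule.span ℂ {H : Matrix N N ℂ | H *ᵥ eP = 0 ∧ H ∈ L}, H' *ᵥ eP = 0 from hspan H hmem
      intro H' hH'
      induction hH' using Submodule.span_induction with
      | mem Y hY => exact hY.1
      | zero => exact zero_mulVec _
      | add Y Y' _ _ hY hY' => rw [add_mulVec, hY, hY', add_zero]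
      | smul c Y _ hY => rw [smul_mulVec, hY, smul_zero]
    obtain ⟨H₀, hH₀, hH₀P⟩ := hnz
    exact hH₀P (hkill H₀ hH₀)
  -- (h) Frobenius reciprocity
  obtain ⟨χ, hχJ, hgood⟩ := exists_mem_forall_apply_eq_of_forall_eq_zero π ρ lam hperm hne hneg hpair hJstab hker' hnz'
  obtain ⟨v, hv, hcv, hPv⟩ := hχJ
  refine ⟨v, hv.1, hPv, hv.2, fun σ hσ ↦ ?_⟩
  -- `σ` fixes the character of `v`, hence `π σ χ = χ`, hence `π σ iP = iP`
  have hfix : π σ χ = χ := by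
    apply Subtype.ext
    rw [hπ, hcv]
    funext A
    by_cases hA : A.map ((↑) : ℚ → ℂ) ∈ L
    · rw [Function.comp_apply, hch_of_mem _ hA]
      exact hσ A hA _ (hev_spec hv _ hA)
    · rw [Function.comp_apply, hch_of_not_mem _ hA, map_zero]
  have hP' := hgood σ hfix
  rcases hswap σ with ⟨h1, -⟩ | ⟨h1, -⟩
  · exact h1
  · exfalso
    apply hne
    apply Subtype.ext
    change ch eP = ch eM
    have h := congrArg Subtype.val hP'
    rw [hπ] at h
    change (σ : ℂ → ℂ) ∘ ch eP = ch eP at h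
    rw [← hchσ σ hJEP, h1] at h
    exact h.symm

end AutStableTorus

end Literature.Geometry.Kaehler

end
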